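import Literature.NumberTheory.Transcendental.MasserSchneiderTau
import HarnessLib

/-!
# Masser 1975 — `τ = ω₂/ω₁` is transcendental (no complex multiplication): the run

Continuation of `MasserSchneiderTau.lean` (support for the book's proof of Theorem II,
`Literature.NumberTheory.Transcendental.masser_ellipticPeriods`): the analytic argument of
§1.3 with `α = τ` EXACT. Since `A_m(τ)` vanishes exactly, the auxiliary function `G = σ…σ·Φ`
has genuine zeros of order `k+1` (`k₁+1`) at the points `s + ¼`, and the extrapolation is the
plain Schwarz lemma (`norm_le_of_small_derivs_quarter` with `η = 0`).

* `Run6`, `Run6.Hyp` — the parameters and the finitely many explicit inequalities;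
* `Run6.contradiction` — Siegel (`exists_solution6`) → zeros up to `k₁` (Schwarz + Cauchy +
  Liouville `exists_Z`) → `|Φ| ≤ MΦ` on `ξ` (Lemma 1.11) → Lemma 1.5 (`Consts.h15`, with the
  admissible `μ` from `norm_quadForm_tau_ge`) → `|p| < Pb₆^{-(h-1)}` against Liouville.

Everything here is proved; no named facts.

## References

* D. W. Masser, *Elliptic Functions and Transcendence*, Lecture Notes in Math. 437, Springer 1975,
  Ch. I §1.3 (proof of Theorem I), Ch. II §2.5 (p. 26). [Masser1975]
-/

noncomputable section

open Complex MvPolynomial NumberField Finset Metric Set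
open scoped PeriodPair

namespace Literature.NumberTheory.Transcendental.Masser1975

/-- The data of one run with `α = τ`: the setup, the constants of the lattice and the integer
parameters `k, n (= L), h, k₁, h₁`. [cite: Masser1975, §1.3] -/
structure Run6 where
  /-- the lattice with algebraic invariants and algebraic `τ` -/
  S : ASetup
  /-- the constants of the lattice -/
  K : Consts S.L
  /-- Masser's `k` -/
  k : ℕ
  /-- Masser's `L` -/
  n : ℕ
  /-- Masser's `h` -/
  h : ℕ
  /-- Masser's `k₁` -/
  k₁ : ℕ
  /-- Masser's `h₁` -/
  h₁ : ℕ

namespace Run6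

variable (P : Run6)

/-- `T₀ = max(1, |ω₁|⁻¹)`. [folklore] -/
def T₀ : ℝ := max 1 ‖P.S.L.ω₁‖⁻¹

/-- The bound `Pc = (n+1)² Pb₆` for `∑ |p(λ₁,λ₂)|`. [folklore] -/
def Pc : ℝ := (((P.n + 1) ^ 2 : ℕ) : ℝ) * P.S.Pb6 P.n P.k

/-- The growth bound `Θ(hh) = Pc e^{CG(n+1)(1+(5(hh+1))²)}` for `G` on `|z| = 5(hh+1)`. [cite: Masser1975, Lemma 1.9] -/
def Θgen (hh : ℕ) : ℝ := P.Pc * Real.exp (P.K.CG * (P.n + 1) * (1 + (5 * ((hh : ℝ) + 1)) ^ 2))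

/-- The extrapolation output `Θ(hh) (5/6)^{(K+1)hh}` (Schwarz with exact zeros). [cite: Masser1975, §1.3 (proof of Lemma 1.10)] -/
def Ggen (K hh : ℕ) : ℝ := P.Θgen hh * (5 / 6 : ℝ) ^ ((K + 1) * hh)

/-- Step 1 output. [folklore] -/
def G₁ : ℝ := P.Ggen P.k P.h

/-- The bound for `|Φ|` on `|z - ¼| = ρ`: `B₁ = G₁ (cσ⁻¹ e^{2Cσ})^{4n}`. [cite: Masser1975, Lemma 1.10 (proof)] -/
def B₁ : ℝ := P.G₁ * (P.K.cσ⁻¹ * Real.exp (P.K.Cσ * 2)) ^ (4 * P.n)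

/-- The bound for `|A_m(τ)|`, `m ≤ k₁`: `U = T₀^{k₁} k₁! B₁ ρ^{-k₁}`. [cite: Masser1975, Lemma 1.10 (proof)] -/
def U : ℝ := P.T₀ ^ P.k₁ * (P.k₁.factorial * P.B₁ / P.K.d.ρ ^ P.k₁)

/-- The conjugate bound `Bc = (n+1)² Pb₆ Amat₆(n,k₁)` for `d^{2n+2k₁} A_m(τ)`. [cite: Masser1975, Lemma 1.10 (proof)] -/
def Bc : ℝ := (((P.n + 1) ^ 2 : ℕ) : ℝ) * P.S.Pb6 P.n P.k * P.S.Amat6 P.n P.k₁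

/-- The Liouville threshold `Λ₁ = Bc^{-(h-1)}`. [cite: Masser1975, Lemma 1.10 (proof)] -/
def Λ₁ : ℝ := (P.Bc ^ (P.S.G6.h - 1))⁻¹

/-- Step 2 output. [folklore] -/
def G₂ : ℝ := P.Ggen P.k₁ P.h₁

/-- The bound `MΦ = G₂ (cσ⁻¹ e^{Cσ(1+(Rn)²)})^{4n}` for `|Φ|` on `ξ ∩ {|z| ≤ Rn}` (Lemma 1.11).
[cite: Masser1975, Lemma 1.11] -/
def MΦ : ℝ := P.G₂ * (P.K.cσ⁻¹ * Real.exp (P.K.Cσ * (1 + (P.K.R * P.n) ^ 2))) ^ (4 * P.n)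

/-- The lower bound `μ = |ω₁|² ((3 C₁₀ n C₆²)^{h-1} d²)⁻¹` for `|Aω₁² + Bω₁ω₂ + Cω₂²|`.
[cite: Masser1975, §1.3 (end, "μ > H^{-c₂₉}")] -/
def μ : ℝ := ‖P.S.L.ω₁‖ ^ 2 *
  ((3 * ((P.K.C₁₀ * P.n : ℕ) : ℝ) * P.S.C6 ^ 2) ^ (P.S.G6.h - 1) * (P.S.d6 : ℝ) ^ 2)⁻¹

/-- **The hypotheses of one run** (they hold for the book's choice of parameters once `k` is
large). [cite: Masser1975, §1.3] -/
structure Hyp : Prop where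
  hk : 1 ≤ P.k
  hkk₁ : P.k ≤ P.k₁
  hn : P.K.N₀ ≤ P.n
  hh : 1 ≤ P.h
  hh₁ : 1 ≤ P.h₁
  hsiegel : 2 * (P.k + 1) ≤ (P.n + 1) ^ 2
  hP1 : P.K.R * P.n ≤ (P.h₁ : ℝ) + 1
  hL1 : (|(P.S.d6 : ℝ)|) ^ (2 * P.n + 2 * P.k₁) * P.U < P.Λ₁
  hF : (P.K.κ * (P.n : ℝ) ^ 2 / P.μ) ^ P.n * P.MΦ < (P.S.Pb6 P.n P.k ^ (P.S.G6.h - 1))⁻¹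

/-! ### Elementary facts -/

/-- `ω₁ ≠ 0`. [folklore] -/
theorem ω₁_ne_zero : P.S.L.ω₁ ≠ 0 := by simpa using basis_ne_zero P.S.L 0

/-- `0 ≤ Pc`. [folklore] -/
theorem Pc_nonneg : 0 ≤ P.Pc := by
  unfold Pc
  exact mul_nonneg (by positivity) (zero_le_one.trans (P.S.one_le_Pb6 P.n P.k))

/-- `0 ≤ Ggen`. [folklore] -/
theorem Ggen_nonneg (K hh : ℕ) : 0 ≤ P.Ggen K hh := by
  unfold Ggen Θgen; have := P.Pc_nonneg; positivity

/-- `|ω₁|^{-m} ≤ T₀^K` for `m ≤ K`. [folklore] -/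
theorem norm_ω₁_inv_pow_le {m K : ℕ} (hm : m ≤ K) : ‖P.S.L.ω₁‖⁻¹ ^ m ≤ P.T₀ ^ K := by
  calc ‖P.S.L.ω₁‖⁻¹ ^ m ≤ P.T₀ ^ m := pow_le_pow_left₀ (by positivity) (le_max_right _ _) m
    _ ≤ P.T₀ ^ K := pow_le_pow_right₀ (le_max_left _ _) hm

/-! ### Step A: exact zeros of `Φ` and `G` at the points `s + ¼` -/

/-- If `A_m(τ) = 0` for `m ≤ K` then `Φ^{(m)}(s + ¼) = 0` for `m ≤ K` (period `1` and
`Φ^{(m)}(¼) = ω₁^m A_m(τ)`). [cite: Masser1975, §1.3 (proof of Lemma 1.10)] -/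
theorem iteratedDeriv_biEval_pt_eq_zero (p : ℕ → ℕ → ℂ) {K : ℕ}
    (hA0 : ∀ m ≤ K, Aval P.S.L P.n p m P.S.τ = 0) (s : ℤ) {m : ℕ} (hm : m ≤ K) :
    iteratedDeriv m (biEval P.S.L P.n p) ((s : ℂ) + 1 / 4) = 0 := by
  rw [show ((s : ℂ) + 1 / 4) = (1 / 4 : ℂ) + s by ring, iteratedDeriv_biEval_add_intCast,
    iteratedDeriv_biEval_quarter_eq_Aval]
  change P.S.L.ω₁ ^ m * Aval P.S.L P.n p m P.S.τ = 0
  rw [hA0 m hm, mul_zero]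

/-- The derivatives of `G` at the nodes vanish as well (Leibniz). [cite: Masser1975, §1.3 (proof of Lemma 1.10, (13))] -/
theorem iteratedDeriv_Gfun_pt_eq_zero (p : ℕ → ℕ → ℂ) {K : ℕ}
    (hA0 : ∀ m ≤ K, Aval P.S.L P.n p m P.S.τ = 0) {hh : ℕ} (s : Fin hh) {m : ℕ} (hm : m < K + 1) :
    ‖iteratedDeriv m (Gfun P.S.L P.n p) (quarterNodes hh s)‖ ≤ 0 * m.factorial := by
  have hm' : m ≤ K := Nat.lt_succ_iff.mp hm
  set c : ℂ := quarterNodes hh s with hc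
  have hcreg := regular_intCast_add_quarter (L := P.S.L) ((s : ℕ) + 1 : ℕ)
  have hc_eq : c = (((((s : ℕ) + 1 : ℕ) : ℤ) : ℂ) + 1 / 4) := by
    simp only [hc, quarterNodes]; push_cast; ring
  have h1 : P.S.L.ω₁ * c ∉ P.S.L.lattice := by rw [hc_eq]; exact_mod_cast hcreg.1
  have h2 : P.S.L.ω₂ * c ∉ P.S.L.lattice := by rw [hc_eq]; exact_mod_cast hcreg.2
  have hΦ : ∀ i ≤ m, iteratedDeriv i (biEval P.S.L P.n p) c = 0 := by
    intro i hi
    rw [hc_eq]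
    exact P.iteratedDeriv_biEval_pt_eq_zero p hA0 _ (hi.trans hm')
  rw [zero_mul]
  refine (norm_iteratedDeriv_Gfun_le P.n p h1 h2 m).trans (le_of_eq ?_)
  refine Finset.sum_eq_zero fun i hi => ?_
  have hi' : i ≤ m := Nat.lt_succ_iff.mp (Finset.mem_range.mp hi)
  rw [hΦ _ (Nat.sub_le m i), norm_zero, mul_zero]

/-! ### Step B: the extrapolation (Schwarz) -/

/-- **Extrapolation**: if `A_m(τ) = 0` for `m ≤ K` then `‖G(w)‖ ≤ Ggen(K, hh)` for `|w| ≤ hh + 1`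
(`hh ≥ 1`). [cite: Masser1975, §1.3 (proofs of Lemmas 1.10, 1.11)] -/
theorem norm_Gfun_le_Ggen (p : ℕ → ℕ → ℂ) (hPc : coeffSum P.n p ≤ P.Pc) {K : ℕ}
    (hA0 : ∀ m ≤ K, Aval P.S.L P.n p m P.S.τ = 0) {hh : ℕ} (hhh : 1 ≤ hh) {w : ℂ}
    (hw : ‖w‖ ≤ (hh : ℝ) + 1) : ‖Gfun P.S.L P.n p w‖ ≤ P.Ggen K hh := by
  have hΘ0 : 0 ≤ P.Θgen hh := by unfold Θgen; have := P.Pc_nonneg; positivity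
  have hΘ : ∀ z ∈ sphere (0 : ℂ) (5 * ((hh : ℝ) + 1)), ‖Gfun P.S.L P.n p z‖ ≤ P.Θgen hh := by
    intro z hz
    have hzn : ‖z‖ = 5 * ((hh : ℝ) + 1) := mem_sphere_zero_iff_norm.mp hz
    refine (P.K.hCG P.n p z).trans ?_
    unfold Θgen
    rw [hzn]
    exact mul_le_mul_of_nonneg_right hPc (by positivity)
  have h := norm_le_of_small_derivs_quarter (differentiable_Gfun P.S.L P.n p) hhh (by omega : 1 ≤ K + 1)
    le_rfl hΘ0 (fun s j hj => P.iteratedDeriv_Gfun_pt_eq_zero p hA0 s hj) hΘ hw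
  simpa [Ggen] using h

/-! ### Step C: Lemma 1.10 — `A_m(τ) = 0` up to `k₁` -/

/-- On the circle `|z - ¼| = ρ`: `|Φ| ≤ B₁`. [cite: Masser1975, §1.3 (proof of Lemma 1.10)] -/
theorem norm_biEval_sphere_le (hP : P.Hyp) (p : ℕ → ℕ → ℂ) (hPc : coeffSum P.n p ≤ P.Pc)
    (hA0 : ∀ m ≤ P.k, Aval P.S.L P.n p m P.S.τ = 0) {z : ℂ} (hz : z ∈ sphere (1 / 4 : ℂ) P.K.d.ρ) :
    ‖biEval P.S.L P.n p z‖ ≤ P.B₁ := by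
  have hzball : z ∈ closedBall (1 / 4 : ℂ) P.K.d.ρ := sphere_subset_closedBall hz
  have hzξ : z ∈ xiSet P.K.d := fun i => ⟨0, P.S.L.lattice.zero_mem, by simpa using hzball⟩
  have hzn : ‖z‖ ≤ 1 := by
    have h1 : ‖z - 1 / 4‖ ≤ P.K.d.ρ := mem_closedBall_iff_norm.mp hzball
    have hρ := P.K.d.ρ_le
    calc ‖z‖ = ‖(z - 1 / 4) + 1 / 4‖ := by ring_nf
      _ ≤ ‖z - 1 / 4‖ + ‖(1 / 4 : ℂ)‖ := norm_add_le _ _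
      _ ≤ P.K.d.ρ + 1 / 4 := by rw [show ‖(1 / 4 : ℂ)‖ = 1 / 4 by norm_num]; linarith
      _ ≤ 1 := by linarith
  have hG : ‖Gfun P.S.L P.n p z‖ ≤ P.G₁ :=
    P.norm_Gfun_le_Ggen p hPc hA0 hP.hh (hzn.trans (by
      have : (1 : ℝ) ≤ P.h := by exact_mod_cast hP.hh
      linarith))
  refine (P.K.hΦ P.n p z hzξ).trans ?_
  unfold B₁
  have hG0 : 0 ≤ P.G₁ := (norm_nonneg _).trans hG
  refine mul_le_mul hG (pow_le_pow_left₀ (by have := P.K.hcσ; positivity) ?_ _) (by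
    have := P.K.hcσ; positivity) hG0
  refine mul_le_mul_of_nonneg_left (Real.exp_le_exp.mpr ?_) (by have := P.K.hcσ; positivity)
  have : ‖z‖ ^ 2 ≤ 1 := by nlinarith [norm_nonneg z]
  nlinarith [P.K.hCσ]

/-- **Lemma 1.10**: `A_m(τ) = 0` for all `m ≤ k₁` (otherwise the algebraic integer
`d^{2n+2k₁} A_m(τ) ≠ 0` would be `< Λ₁` in absolute value, against Liouville).
[cite: Masser1975, Lemma 1.10] -/
theorem Aval_tau_eq_zero_upto_k₁ (hP : P.Hyp) {ξ : Fin (P.n + 1) × Fin (P.n + 1) → 𝓞 P.S.K6}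
    (hPb : ∀ ij, house ((ξ ij : 𝓞 P.S.K6) : P.S.K6) ≤ P.S.Pb6 P.n P.k)
    (hA0 : ∀ m ≤ P.k, Aval P.S.L P.n (P.S.pFun6 ξ) m P.S.τ = 0)
    (hPc : coeffSum P.n (P.S.pFun6 ξ) ≤ P.Pc)
    {m : ℕ} (hm : m ≤ P.k₁) : Aval P.S.L P.n (P.S.pFun6 ξ) m P.S.τ = 0 := by
  set p := P.S.pFun6 ξ with hp
  by_contra hne
  -- the upper bound `|A_m(τ)| ≤ U`
  have hB : ∀ z ∈ sphere (1 / 4 : ℂ) P.K.d.ρ, ‖biEval P.S.L P.n p z‖ ≤ P.B₁ := fun z hz =>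
    P.norm_biEval_sphere_le hP p hPc hA0 hz
  have hcauchy := norm_iteratedDeriv_biEval_quarter_le P.K.d P.n p hB m
  have hΦm : ‖iteratedDeriv m (biEval P.S.L P.n p) (1 / 4)‖ = ‖P.S.L.ω₁‖ ^ m *
      ‖Aval P.S.L P.n p m P.S.τ‖ := by
    rw [iteratedDeriv_biEval_quarter_eq_Aval, norm_mul, norm_pow]; rfl
  have hω : 0 < ‖P.S.L.ω₁‖ := norm_pos_iff.mpr P.ω₁_ne_zero
  have hpt : ((1 / 4 : ℂ) + (P.K.d.ρ : ℂ)) ∈ sphere (1 / 4 : ℂ) P.K.d.ρ := by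
    rw [mem_sphere_iff_norm, add_sub_cancel_left, Complex.norm_real, Real.norm_eq_abs,
      abs_of_pos P.K.d.ρ_pos]
  have hB₁0 : 0 ≤ P.B₁ := (norm_nonneg _).trans (hB _ hpt)
  have hAτ : ‖Aval P.S.L P.n p m P.S.τ‖ ≤ P.U := by
    have h1 : ‖Aval P.S.L P.n p m P.S.τ‖ = ‖P.S.L.ω₁‖⁻¹ ^ m * ‖iteratedDeriv m (biEval P.S.L P.n p) (1 / 4)‖ := by
      rw [hΦm, ← mul_assoc, ← mul_pow, inv_mul_cancel₀ hω.ne', one_pow, one_mul]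
    rw [h1]
    have hρ := P.K.d.ρ_pos
    have hρ1 : P.K.d.ρ ≤ 1 := P.K.d.ρ_le.trans (by norm_num)
    have h2 : (m.factorial : ℝ) * P.B₁ / P.K.d.ρ ^ m ≤ P.k₁.factorial * P.B₁ / P.K.d.ρ ^ P.k₁ := by
      have hf : (m.factorial : ℝ) ≤ P.k₁.factorial := by exact_mod_cast Nat.factorial_le hm
      have hρpow : P.K.d.ρ ^ P.k₁ ≤ P.K.d.ρ ^ m := pow_le_pow_of_le_one hρ.le hρ1 hm
      rw [div_le_div_iff₀ (pow_pos hρ _) (pow_pos hρ _)]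
      exact mul_le_mul (mul_le_mul hf le_rfl hB₁0 (by positivity)) hρpow (pow_nonneg hρ.le _)
        (mul_nonneg (by positivity) hB₁0)
    exact mul_le_mul (P.norm_ω₁_inv_pow_le hm) (hcauchy.trans h2) (norm_nonneg _)
      (pow_nonneg (zero_le_one.trans (le_max_left _ _)) _)
  -- the algebraic integer `Z = d^{2n+2k₁} A_m(τ)`
  have hPb1 := P.S.one_le_Pb6 P.n P.k
  obtain ⟨x, hx, hxc⟩ := P.S.exists_Z ξ hPb1 hPb (K := P.k₁) hm
  have hd0 : (P.S.d6 : ℂ) ≠ 0 := by exact_mod_cast P.S.G6.den_ne_zero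
  have hxne : x ≠ 0 := by
    intro h0
    have : ((x : P.S.K6) : ℂ) = 0 := by rw [h0]; simp
    rw [hx] at this
    exact (mul_ne_zero (pow_ne_zero _ hd0) hne) this
  have hBc1 : 1 ≤ P.Bc := by
    unfold Bc
    have hq : (1 : ℝ) ≤ (((P.n + 1) ^ 2 : ℕ) : ℝ) := by exact_mod_cast Nat.one_le_pow _ _ (by omega)
    exact one_le_mul_of_one_le_of_one_le (one_le_mul_of_one_le_of_one_le hq hPb1) (P.S.one_le_Amat6 _ _)
  have hconj : ∀ σ : P.S.K6 →+* ℂ, ‖σ (x : P.S.K6)‖ ≤ P.Bc := fun σ => by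
    have := hxc σ; unfold Bc; exact this
  have hliou := P.S.G6.norm_ge_of_forall_norm_le hxne hBc1 hconj
  -- but `|Z| ≤ |d|^{2n+2k₁} U < Λ₁`
  have hupper : ‖((x : P.S.K6) : ℂ)‖ ≤ (|(P.S.d6 : ℝ)|) ^ (2 * P.n + 2 * P.k₁) * P.U := by
    rw [hx, norm_mul, norm_pow, Complex.norm_intCast]
    exact mul_le_mul_of_nonneg_left hAτ (by positivity)
  have : P.Λ₁ ≤ (|(P.S.d6 : ℝ)|) ^ (2 * P.n + 2 * P.k₁) * P.U := by
    unfold Λ₁; exact hliou.trans hupper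
  exact absurd hP.hL1 (not_lt.mpr this)

/-! ### Step D: Lemma 1.11 — `Φ` is small on `ξ` -/

/-- **Lemma 1.11**: `‖Φ(ζ)‖ ≤ MΦ` for `ζ ∈ ξ`, `|ζ| ≤ R n`. [cite: Masser1975, Lemma 1.11] -/
theorem norm_biEval_le_MΦ (hP : P.Hyp) (p : ℕ → ℕ → ℂ) (hPc : coeffSum P.n p ≤ P.Pc)
    (hA0 : ∀ m ≤ P.k₁, Aval P.S.L P.n p m P.S.τ = 0) {ζ : ℂ} (hζ : ζ ∈ xiSet P.K.d)
    (hζn : ‖ζ‖ ≤ P.K.R * P.n) : ‖biEval P.S.L P.n p ζ‖ ≤ P.MΦ := by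
  have hG : ‖Gfun P.S.L P.n p ζ‖ ≤ P.G₂ :=
    P.norm_Gfun_le_Ggen p hPc hA0 hP.hh₁ (hζn.trans hP.hP1)
  refine (P.K.hΦ P.n p ζ hζ).trans ?_
  unfold MΦ
  have hG0 : 0 ≤ P.G₂ := (norm_nonneg _).trans hG
  have hc := P.K.hcσ
  refine mul_le_mul hG (pow_le_pow_left₀ (by positivity) ?_ _) (by positivity) hG0
  refine mul_le_mul_of_nonneg_left (Real.exp_le_exp.mpr ?_) (by positivity)
  have hR0 := P.K.hR.le
  have : ‖ζ‖ ^ 2 ≤ (P.K.R * P.n) ^ 2 := pow_le_pow_left₀ (norm_nonneg _) hζn 2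
  nlinarith [P.K.hCσ]

/-! ### Step E: the lower bound `μ` -/

/-- **`μ` is admissible**: `μ ≤ |Aω₁² + Bω₁ω₂ + Cω₂²|` for integer `(A,B,C) ≠ 0` with
`|A|,|B|,|C| ≤ C₁₀ n` (Liouville for `A + Bτ + Cτ² ≠ 0`). [cite: Masser1975, §1.3 (end of the proof of Thm I)] -/
theorem μ_le_periodForm (hP : P.Hyp) (v : ℤ × ℤ × ℤ) (hv : v ≠ 0)
    (h1 : |v.1| ≤ P.K.C₁₀ * P.n) (h2 : |v.2.1| ≤ P.K.C₁₀ * P.n) (h3 : |v.2.2| ≤ P.K.C₁₀ * P.n) :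
    P.μ ≤ ‖periodForm P.S.L v‖ := by
  obtain ⟨A', B', C'⟩ := v
  simp only at h1 h2 h3
  have hω := P.ω₁_ne_zero
  have hform : periodForm P.S.L (A', B', C') = P.S.L.ω₁ ^ 2 *
      ((A' : ℂ) + (B' : ℂ) * P.S.τ + (C' : ℂ) * P.S.τ ^ 2) := by
    unfold periodForm ASetup.τ
    field_simp
  have hvne : ((A', B', C') : ℤ × ℤ × ℤ) ≠ (0, 0, 0) := hv
  have hX1 : 1 ≤ P.K.C₁₀ * P.n :=
    Nat.one_le_iff_ne_zero.mpr (Nat.mul_ne_zero (by have := P.K.hC₁₀; omega)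
      (by have := P.K.hN₀.trans hP.hn; omega))
  have hq := P.S.norm_quadForm_tau_ge hvne hX1 h1 h2 h3
  rw [hform, norm_mul, norm_pow]
  unfold μ
  exact mul_le_mul_of_nonneg_left hq (by positivity)

/-- `0 < μ`. [folklore] -/
theorem μ_pos (hP : P.Hyp) : 0 < P.μ := by
  unfold μ
  have hω : 0 < ‖P.S.L.ω₁‖ := norm_pos_iff.mpr P.ω₁_ne_zero
  have hC6 : 0 < P.S.C6 := lt_of_lt_of_le one_pos P.S.one_le_C6
  have hd : (P.S.d6 : ℝ) ≠ 0 := by exact_mod_cast P.S.G6.den_ne_zero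
  have hX1 : 1 ≤ P.K.C₁₀ * P.n :=
    Nat.one_le_iff_ne_zero.mpr (Nat.mul_ne_zero (by have := P.K.hC₁₀; omega)
      (by have := P.K.hN₀.trans hP.hn; omega))
  have hX0 : (0 : ℝ) < ((P.K.C₁₀ * P.n : ℕ) : ℝ) := by exact_mod_cast hX1
  positivity

/-! ### The contradiction -/

/-- **The argument of §1.3 closes with `α = τ`**: under `Hyp` one gets `False`.
[cite: Masser1975, §1.3 (proof of Thm I, pp. 9–10) / §2.5 ("ω₂/ω₁ is transcendental")] -/
theorem contradiction (hP : P.Hyp) : False := by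
  obtain ⟨ξ, hξ0, hMξ, hhouse⟩ := P.S.exists_solution6 (n := P.n) (k := P.k) hP.hsiegel
  set p : ℕ → ℕ → ℂ := P.S.pFun6 ξ with hp
  have hA0k : ∀ m ≤ P.k, Aval P.S.L P.n p m P.S.τ = 0 := fun m hm =>
    P.S.Aval_tau_eq_zero_of_mulVec6 hMξ hm
  have hPb1 := P.S.one_le_Pb6 P.n P.k
  have hpB : ∀ i j, ‖p i j‖ ≤ P.S.Pb6 P.n P.k := fun i j =>
    P.S.norm_pFun6_le ξ (zero_le_one.trans hPb1) hhouse i j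
  have hPc : coeffSum P.n p ≤ P.Pc := by
    unfold coeffSum Pc
    calc ∑ i ∈ Finset.range (P.n + 1), ∑ j ∈ Finset.range (P.n + 1), ‖p i j‖
        ≤ ∑ _i ∈ Finset.range (P.n + 1), ∑ _j ∈ Finset.range (P.n + 1), P.S.Pb6 P.n P.k :=
          Finset.sum_le_sum fun i _ => Finset.sum_le_sum fun j _ => hpB i j
      _ = (((P.n + 1) ^ 2 : ℕ) : ℝ) * P.S.Pb6 P.n P.k := by
          rw [Finset.sum_const, Finset.card_range, Finset.sum_const, Finset.card_range, nsmul_eq_mul,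
            nsmul_eq_mul]
          push_cast; ring
  -- Lemma 1.10
  have hA0 : ∀ m ≤ P.k₁, Aval P.S.L P.n p m P.S.τ = 0 := fun m hm =>
    P.Aval_tau_eq_zero_upto_k₁ hP hhouse hA0k hPc hm
  -- Lemma 1.11 and Lemma 1.5
  have hM : ∀ z ∈ xiSet P.K.d, ‖z‖ ≤ P.K.R * P.n → ‖biEval P.S.L P.n p z‖ ≤ P.MΦ :=
    fun z hz hzn => P.norm_biEval_le_MΦ hP p hPc hA0 hz hzn
  have hμ := P.μ_pos hP
  have h15 := P.K.h15 P.n hP.hn p P.MΦ P.μ hμ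
    (fun v hv h1 h2 h3 => P.μ_le_periodForm hP v hv h1 h2 h3) hM
  -- a non-zero coefficient and its Liouville bound
  obtain ⟨ij, hij⟩ : ∃ ij, ξ ij ≠ 0 := by
    by_contra h
    push Not at h
    exact hξ0 (funext h)
  have hlow := P.S.norm_pFun6_ge ξ hPb1 hhouse ij hij
  have hup := h15 ij.1 ij.2 (Nat.lt_succ_iff.mp ij.1.isLt) (Nat.lt_succ_iff.mp ij.2.isLt)
  have hF := hP.hF
  change (P.S.Pb6 P.n P.k ^ (P.S.G6.h - 1))⁻¹ ≤ ‖p ij.1 ij.2‖ at hlow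
  linarith

end Run6

end Literature.NumberTheory.Transcendental.Masser1975
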